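import Mathlib.LinearAlgebra.Matrix.Adjugate
import Mathlib.LinearAlgebra.Matrix.GeneralLinearGroup.Defs
import Mathlib.Tactic.FinCases
import Mathlib.Tactic.NormNum
import HarnessLib

/-!
# The adjugate duality of orientations (stub `stub_adjugateDualCocycle`) — line `sector-klingen-split`,
# crux `ResiduallyYoshidaLifting` (stmt-Langlands-13639)

Stub-worker of lead prover-line-stmt-Langlands-13639-c5-0 (2026-08-17), skeleton rev 13, sub-goal D2 (the pure `2 × 2` matrix
algebra behind the dual integral frame `ν · rint⁻ᵀ`, which realises a residual cocycle in the OPPOSITE orientation).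

For a pair `σ̄, σ̄' : Γ → GL₂(k)` with a COMMON determinant `d` (a unit), the adjugate duality
`D B g = -d(g)⁻¹ • (σ̄'(g) · adj(B g) · σ̄(g))` and its mirror `D'` (roles of `σ̄, σ̄'` exchanged) are mutually inverse `k`-linear
maps on functions `Γ → M₂(k)`; `D` carries `Hom(σ̄', σ̄)`-valued 1-cocycles (`B(gg') = σ̄ g B g' + B g σ̄' g'`) to
`Hom(σ̄, σ̄')`-valued ones (`(D B)(gg') = σ̄' g (D B) g' + (D B) g σ̄ g'`), and `B` is a coboundary `σ̄ X - X σ̄'` iff `D B` is a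
coboundary `σ̄' X' - X' σ̄` (with `X' = -adj X`; the converse applies the forward direction to `D'` and the involution).

Ingredients (all Mathlib, over any commutative ring for the cores): on `M₂` the classical adjugate is LINEAR
(`Matrix.adjugate_fin_two`, `Matrix.adjugate_smul` with exponent `card - 1 = 1`), anti-multiplicative (`Matrix.adjugate_mul_distrib`),
involutive (`Matrix.adjugate_adjugate` with exponent `card - 2 = 0`), and `S · adj S = adj S · S = det S • 1`
(`Matrix.mul_adjugate`, `Matrix.adjugate_mul`).  Computations: `D'(D B) = d⁻² • S (adj S) B (adj S') S' = B`;
`adj(S_g B_h + B_g S'_h) = adj B_h adj S_g + adj S'_h adj B_g`; `adj(S X - X S') = adj X adj S - adj S' adj X`.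

Pure Mathlib matrix algebra; no named facts.
-/

noncomputable section

set_option linter.dupNamespace false
set_option autoImplicit false

open scoped Matrix

namespace Summit.Langlands.Langlands.Cruxes.ResiduallyYoshidaLifting.SectorKlingenSplit.Fibre

/-! ## The classical adjugate on `2 × 2` matrices is linear and involutive -/

/-- On `2 × 2` matrices the adjugate is homogeneous of degree one: `adj (c • A) = c • adj A`
(`Matrix.adjugate_smul` with exponent `card (Fin 2) - 1 = 1`). [folklore] -/
theorem adjugate_two_smul {R : Type*} [CommRing R] (c : R) (A : Matrix (Fin 2) (Fin 2) R) :
    (c • A).adjugate = c • A.adjugate := by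
  rw [Matrix.adjugate_smul, Fintype.card_fin, Nat.add_one_sub_one, pow_one]

/-- On `2 × 2` matrices the adjugate is additive: `adj (A + B) = adj A + adj B` (entrywise from `Matrix.adjugate_fin_two`;
false in size `≥ 3`). [folklore] -/
theorem adjugate_two_add {R : Type*} [CommRing R] (A B : Matrix (Fin 2) (Fin 2) R) :
    (A + B).adjugate = A.adjugate + B.adjugate := by
  rw [Matrix.adjugate_fin_two, Matrix.adjugate_fin_two, Matrix.adjugate_fin_two]
  ext i j
  fin_cases i <;> fin_cases j <;> simp [add_comm]

/-- On `2 × 2` matrices `adj (-A) = -adj A`. [folklore] -/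
theorem adjugate_two_neg {R : Type*} [CommRing R] (A : Matrix (Fin 2) (Fin 2) R) :
    (-A).adjugate = -A.adjugate := by
  rw [← neg_one_smul R A, adjugate_two_smul, neg_one_smul]

/-- On `2 × 2` matrices the adjugate is subtractive: `adj (A - B) = adj A - adj B`. [folklore] -/
theorem adjugate_two_sub {R : Type*} [CommRing R] (A B : Matrix (Fin 2) (Fin 2) R) :
    (A - B).adjugate = A.adjugate - B.adjugate := by
  rw [sub_eq_add_neg, adjugate_two_add, adjugate_two_neg, ← sub_eq_add_neg]

/-- On `2 × 2` matrices the adjugate is an involution: `adj (adj A) = A` (`Matrix.adjugate_adjugate` with exponent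
`card (Fin 2) - 2 = 0`). [folklore] -/
theorem adjugate_two_adjugate {R : Type*} [CommRing R] (A : Matrix (Fin 2) (Fin 2) R) :
    A.adjugate.adjugate = A := by
  rw [Matrix.adjugate_adjugate A (by simp), Fintype.card_fin, Nat.sub_self, pow_zero, one_smul]

/-- Left cancellation `S · (adj S · X) = det S • X` (`Matrix.mul_adjugate`). [folklore] -/
theorem mul_adjugate_mul_cancel {R : Type*} [CommRing R] {n : Type*} [Fintype n] [DecidableEq n]
    (S X : Matrix n n R) : S * (S.adjugate * X) = S.det • X := by
  rw [← Matrix.mul_assoc, Matrix.mul_adjugate, Matrix.smul_mul, Matrix.one_mul]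

/-- Left cancellation `adj S · (S · X) = det S • X` (`Matrix.adjugate_mul`). [folklore] -/
theorem adjugate_mul_mul_cancel {R : Type*} [CommRing R] {n : Type*} [Fintype n] [DecidableEq n]
    (S X : Matrix n n R) : S.adjugate * (S * X) = S.det • X := by
  rw [← Matrix.mul_assoc, Matrix.adjugate_mul, Matrix.smul_mul, Matrix.one_mul]

/-! ## The four single-matrix cores of the duality `B ↦ -d⁻¹ • (S' · adj B · S)` -/

/-- Involution core: for `2 × 2` matrices `S, S'` of common unit determinant `u`,
`-u⁻¹ • (S · adj(-u⁻¹ • (S' · adj B · S)) · S') = B`. [folklore] -/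
theorem dualCore_involutive {R : Type*} [CommRing R] (S S' B : Matrix (Fin 2) (Fin 2) R) (u : Rˣ)
    (hS : S.det = u) (hS' : S'.det = u) :
    -((u⁻¹ : Rˣ) : R) • (S * (-((u⁻¹ : Rˣ) : R) • (S' * B.adjugate * S)).adjugate * S') = B := by
  rw [adjugate_two_smul, Matrix.adjugate_mul_distrib, Matrix.adjugate_mul_distrib, adjugate_two_adjugate,
    Matrix.mul_smul, Matrix.smul_mul, smul_smul]
  have h1 : S * (S.adjugate * (B * S'.adjugate)) * S' = ((u : R) * u) • B := by
    rw [mul_adjugate_mul_cancel, hS, Matrix.smul_mul, Matrix.mul_assoc, Matrix.adjugate_mul, hS',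
      Matrix.mul_smul, Matrix.mul_one, smul_smul, mul_comm]
  rw [h1, smul_smul, neg_mul_neg, mul_mul_mul_comm, Units.inv_mul, one_mul, one_smul]

/-- Linearity core: `a • (S' · adj(c • B₁ + B₂) · S) = c • (a • (S' · adj B₁ · S)) + a • (S' · adj B₂ · S)`. [folklore] -/
theorem dualCore_linear {R : Type*} [CommRing R] (S S' B₁ B₂ : Matrix (Fin 2) (Fin 2) R) (a c : R) :
    a • (S' * (c • B₁ + B₂).adjugate * S) = c • (a • (S' * B₁.adjugate * S)) + a • (S' * B₂.adjugate * S) := by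
  rw [adjugate_two_add, adjugate_two_smul, Matrix.mul_add, Matrix.add_mul, smul_add, Matrix.mul_smul,
    Matrix.smul_mul, smul_comm c a]

/-- Cocycle core: if `det S_g = u` and `det S'_h = v` then
`-(uv)⁻¹ • (S'_g S'_h · adj(S_g B_h + B_g S'_h) · S_g S_h) = S'_g · (-v⁻¹ • (S'_h adj B_h S_h)) + (-u⁻¹ • (S'_g adj B_g S_g)) · S_h`
(`adj` additive and anti-multiplicative, `adj S_g · S_g = u • 1`, `S'_h · adj S'_h = v • 1`). [folklore] -/
theorem dualCore_cocycle {R : Type*} [CommRing R] (Sg Sh S'g S'h Bg Bh : Matrix (Fin 2) (Fin 2) R) (u v : Rˣ)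
    (hSg : Sg.det = u) (hS'h : S'h.det = v) :
    -(((u * v)⁻¹ : Rˣ) : R) • (S'g * S'h * (Sg * Bh + Bg * S'h).adjugate * (Sg * Sh)) =
      S'g * (-((v⁻¹ : Rˣ) : R) • (S'h * Bh.adjugate * Sh)) + -((u⁻¹ : Rˣ) : R) • (S'g * Bg.adjugate * Sg) * Sh := by
  have c1 : -(((u * v)⁻¹ : Rˣ) : R) * (u : R) = -((v⁻¹ : Rˣ) : R) := by
    rw [mul_inv_rev, Units.val_mul, neg_mul, Units.inv_mul_cancel_right]
  have c2 : -(((u * v)⁻¹ : Rˣ) : R) * (v : R) = -((u⁻¹ : Rˣ) : R) := by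
    rw [mul_inv, Units.val_mul, neg_mul, Units.inv_mul_cancel_right]
  rw [adjugate_two_add, Matrix.adjugate_mul_distrib, Matrix.adjugate_mul_distrib, Matrix.mul_add, Matrix.add_mul,
    smul_add]
  simp only [Matrix.mul_assoc, Matrix.mul_smul, Matrix.smul_mul]
  rw [adjugate_mul_mul_cancel, hSg, mul_adjugate_mul_cancel, hS'h]
  simp only [Matrix.mul_smul, smul_smul, c1, c2]

/-- Coboundary core: for `2 × 2` matrices `S, S'` of common unit determinant `u`,
`-u⁻¹ • (S' · adj(S X - X S') · S) = S' · (-adj X) - (-adj X) · S`. [folklore] -/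
theorem dualCore_coboundary {R : Type*} [CommRing R] (S S' X : Matrix (Fin 2) (Fin 2) R) (u : Rˣ)
    (hS : S.det = u) (hS' : S'.det = u) :
    -((u⁻¹ : Rˣ) : R) • (S' * (S * X - X * S').adjugate * S) = S' * (-X.adjugate) - (-X.adjugate) * S := by
  rw [adjugate_two_sub, Matrix.adjugate_mul_distrib, Matrix.adjugate_mul_distrib, Matrix.mul_sub, Matrix.sub_mul,
    smul_sub, Matrix.mul_neg, Matrix.neg_mul]
  simp only [Matrix.mul_assoc]
  rw [Matrix.adjugate_mul, hS, mul_adjugate_mul_cancel, hS', Matrix.mul_smul, Matrix.mul_one, Matrix.mul_smul,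
    smul_smul, smul_smul, neg_mul, Units.inv_mul, neg_one_smul, neg_one_smul]

/-! ## The duality on functions `Γ → M₂(k)` -/

/-- Forward half of the adjugate duality for an ORDERED pair `(σ̄, σ̄')` of common determinant `d`: the map
`D B g = -d(g)⁻¹ • (σ̄'(g) · adj(B g) · σ̄(g))` is `k`-linear, carries cocycles `B(gg') = σ̄ g B g' + B g σ̄' g'` to cocycles
`(D B)(gg') = σ̄' g (D B) g' + (D B) g σ̄ g'`, and carries the coboundary `σ̄ X - X σ̄'` to the coboundary `σ̄' X' - X' σ̄`,
`X' = -adj X`. [folklore] -/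
theorem dual_forward (k : Type) [Field k] (Γ : Type) [Group Γ] (σ σ' : Γ →* GL (Fin 2) k) (d : Γ → kˣ)
    (hσ : ∀ g, (σ g).val.det = d g) (hσ' : ∀ g, (σ' g).val.det = d g)
    (D : (Γ → Matrix (Fin 2) (Fin 2) k) → Γ → Matrix (Fin 2) (Fin 2) k)
    (hD : ∀ B g, D B g = -(((d g)⁻¹ : kˣ) : k) • ((σ' g).val * (B g).adjugate * (σ g).val)) :
    (∀ (B₁ B₂ : Γ → Matrix (Fin 2) (Fin 2) k) (c : k), D (c • B₁ + B₂) = c • D B₁ + D B₂) ∧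
    (∀ B : Γ → Matrix (Fin 2) (Fin 2) k,
      (∀ g g', B (g * g') = (σ g).val * B g' + B g * (σ' g').val) →
      ∀ g g', D B (g * g') = (σ' g).val * D B g' + D B g * (σ g').val) ∧
    (∀ (B : Γ → Matrix (Fin 2) (Fin 2) k) (X : Matrix (Fin 2) (Fin 2) k),
      (∀ g, B g = (σ g).val * X - X * (σ' g).val) →
      ∀ g, D B g = (σ' g).val * (-X.adjugate) - (-X.adjugate) * (σ g).val) := by
  refine ⟨fun B₁ B₂ c => ?_, fun B hB g g' => ?_, fun B X hX g => ?_⟩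
  · funext g
    simp only [hD, Pi.add_apply, Pi.smul_apply]
    exact dualCore_linear _ _ _ _ _ _
  · have hd : d (g * g') = d g * d g' := Units.ext <| by
      rw [Units.val_mul, ← hσ, ← hσ, ← hσ, map_mul, Units.val_mul, Matrix.det_mul]
    simp only [hD]
    rw [hB, hd, map_mul, map_mul, Units.val_mul, Units.val_mul]
    exact dualCore_cocycle _ _ _ _ _ _ _ _ (hσ g) (hσ' g')
  · rw [hD, hX]
    exact dualCore_coboundary _ _ _ _ (hσ g) (hσ' g)

/-- Involution half of the adjugate duality: with `D` as in `dual_forward` and `D'` its mirror (roles of `σ̄, σ̄'` exchanged),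
`D' (D B) = B`. [folklore] -/
theorem dual_involutive (k : Type) [Field k] (Γ : Type) [Group Γ] (σ σ' : Γ →* GL (Fin 2) k) (d : Γ → kˣ)
    (hσ : ∀ g, (σ g).val.det = d g) (hσ' : ∀ g, (σ' g).val.det = d g)
    (D D' : (Γ → Matrix (Fin 2) (Fin 2) k) → Γ → Matrix (Fin 2) (Fin 2) k)
    (hD : ∀ B g, D B g = -(((d g)⁻¹ : kˣ) : k) • ((σ' g).val * (B g).adjugate * (σ g).val))
    (hD' : ∀ B g, D' B g = -(((d g)⁻¹ : kˣ) : k) • ((σ g).val * (B g).adjugate * (σ' g).val)) :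
    ∀ B, D' (D B) = B := by
  intro B
  funext g
  rw [hD', hD]
  exact dualCore_involutive _ _ _ _ (hσ g) (hσ' g)

/-- **Registered sub-goal D2 `stub_adjugateDualCocycle`** (skeleton rev 13 of line `sector-klingen-split`): for a pair
`σ̄, σ̄' : Γ → GL₂(k)` with a COMMON determinant `d`, the adjugate duality `D B (g) = -d(g)⁻¹ • (σ̄'(g) · adj(B g) · σ̄(g))`
and its mirror `D'` (roles of `σ̄, σ̄'` exchanged) are mutually inverse `k`-linear maps; `D` carries `Hom(σ̄', σ̄)`-valued
1-cocycles (`B(gg') = σ̄ g B g' + B g σ̄' g'`) to `Hom(σ̄, σ̄')`-valued ones and `B` is a coboundary `σ̄ X - X σ̄'` iff `D B` is a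
coboundary `σ̄' X' - X' σ̄` (`adj` is linear and anti-multiplicative on `M₂`, `adj S = d · S⁻¹`, `adj (adj B) = B`). [folklore] -/
theorem stub_adjugateDualCocycle :
    ∀ (k : Type) [Field k] (Γ : Type) [Group Γ] (σ σ' : Γ →* GL (Fin 2) k) (d : Γ → kˣ),
      (∀ g, (σ g).val.det = d g) → (∀ g, (σ' g).val.det = d g) →
      ∀ (D D' : (Γ → Matrix (Fin 2) (Fin 2) k) → Γ → Matrix (Fin 2) (Fin 2) k),
      (∀ B g, D B g = -(((d g)⁻¹ : kˣ) : k) • ((σ' g).val * (B g).adjugate * (σ g).val)) →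
      (∀ B g, D' B g = -(((d g)⁻¹ : kˣ) : k) • ((σ g).val * (B g).adjugate * (σ' g).val)) →
      (∀ B, D' (D B) = B) ∧ (∀ B, D (D' B) = B) ∧
      (∀ (B₁ B₂ : Γ → Matrix (Fin 2) (Fin 2) k) (c : k), D (c • B₁ + B₂) = c • D B₁ + D B₂) ∧
      (∀ B : Γ → Matrix (Fin 2) (Fin 2) k,
        (∀ g g', B (g * g') = (σ g).val * B g' + B g * (σ' g').val) →
        ∀ g g', D B (g * g') = (σ' g).val * D B g' + D B g * (σ g').val) ∧
      (∀ B : Γ → Matrix (Fin 2) (Fin 2) k,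
        (∃ X : Matrix (Fin 2) (Fin 2) k, ∀ g, B g = (σ g).val * X - X * (σ' g).val) ↔
        (∃ X : Matrix (Fin 2) (Fin 2) k, ∀ g, D B g = (σ' g).val * X - X * (σ g).val)) := by
  intro k _ Γ _ σ σ' d hσ hσ' D D' hD hD'
  obtain ⟨hlin, hcoc, hcob⟩ := dual_forward k Γ σ σ' d hσ hσ' D hD
  obtain ⟨-, -, hcob'⟩ := dual_forward k Γ σ' σ d hσ' hσ D' hD'
  have hinv : ∀ B, D' (D B) = B := dual_involutive k Γ σ σ' d hσ hσ' D D' hD hD'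
  have hinv' : ∀ B, D (D' B) = B := dual_involutive k Γ σ' σ d hσ' hσ D' D hD' hD
  refine ⟨hinv, hinv', hlin, hcoc, fun B => ⟨?_, ?_⟩⟩
  · rintro ⟨X, hX⟩
    exact ⟨-X.adjugate, hcob B X hX⟩
  · rintro ⟨X, hX⟩
    refine ⟨-X.adjugate, fun g => ?_⟩
    have h := hcob' (D B) X hX g
    rwa [hinv B] at h

end Summit.Langlands.Langlands.Cruxes.ResiduallyYoshidaLifting.SectorKlingenSplit.Fibre

end
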